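import Mathlib

/-!
# LINE `valuative_door` (crux `WeakLifting`, stmt-ValiantsHypothesis-19561) — DOMINANT EXPONENTS OF A PRODUCT (non-archimedean `v`):
# `#dominant (f·g) + 1 ≤ #dominant f + #dominant g`, i.e. the skeleton's `npEdges v (f * g) ≤ npEdges v f + npEdges v g`

HONEST FRAMING.  Helper (cell `pub-symmetroid`, seat val-sym-lift-p1 g21, 2026-08-29; `--supports 19561 --as helper`), toward the line's
lemma `ValCongruenceLemma` («located inflation is harmless under common congruence»: `det = det(A)² · Π_i (Σ_l D_l(i) X^{d_l})` has at most
`m (K − 1)` root radii — "det is multiplicative and the root radii of a product are the union").  Def-free, on the raw `domCount` predicate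
(«`E` strictly dominates every other support exponent at some radius `r > 0`»).  For a NON-ARCHIMEDEAN absolute value: (1) `dominant_mul` —
if `a` dominates `f` and `b` dominates `g` at the same radius then `a + b` dominates `f * g` there (ultrametric equality case on the
antidiagonal); (2) `exists_dominant_pair_of_dominant_mul` — conversely a dominant exponent `G` of `f * g` at radius `r` forces UNIQUE
maximal weighted terms `a` of `f` and `b` of `g` at `r`, with `a + b = G`; (3) maximisers move monotonically with the radius
(`dominantAt_mono`), so the realised pairs `(a, b)` form a chain for the product order — the COUNT `#D(f g) ≤ #D(f) + #D(g) − 1`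
(a chain in `D(f) × D(g)` is short) is assembled in the companion file `…ValuativeDoorProductCount`.  Nothing here is a stub of the line or closes anything; no bearing on vW / vB /
`ValRankOneLaw`, `TropicalB`, `MatrixDescartes` (18050) or VP ≠ VNP.  [elementary; Newton-polygon folklore spelled on the raw predicate]
-/

set_option linter.dupNamespace false
set_option autoImplicit false

namespace Summit.ValiantsHypothesis.ValiantsHypothesis.Theorems.KPlusLogSqLaw.ValDoor

open Polynomial Finset
open scoped BigOperators Classical

variable {F : Type*} [Field F]

/-- **product of dominant terms dominates the product** (non-archimedean `v`): if `a` strictly dominates `f` and `b` strictly dominates `g`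
at the radius `r > 0` (against ALL other indices), then `v ((f*g).coeff (a+b)) = v (f.coeff a) * v (g.coeff b)` and `a + b` strictly
dominates `f * g` at `r`. [elementary, ultrametric] -/
theorem dominant_mul (v : AbsoluteValue F ℝ) (hv : IsNonarchimedean v) (f g : F[X]) {a b : ℕ} {r : ℝ} (hr : 0 < r)
    (ha : f.coeff a ≠ 0) (hb : g.coeff b ≠ 0)
    (hfa : ∀ a' : ℕ, a' ≠ a → v (f.coeff a') * r ^ a' < v (f.coeff a) * r ^ a)
    (hgb : ∀ b' : ℕ, b' ≠ b → v (g.coeff b') * r ^ b' < v (g.coeff b) * r ^ b) :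
    v ((f * g).coeff (a + b)) = v (f.coeff a) * v (g.coeff b) ∧
      ∀ G : ℕ, G ≠ a + b → v ((f * g).coeff G) * r ^ G < v ((f * g).coeff (a + b)) * r ^ (a + b) := by
  have hwa : 0 < v (f.coeff a) * r ^ a := mul_pos (v.pos ha) (pow_pos hr a)
  have hwb : 0 < v (g.coeff b) * r ^ b := mul_pos (v.pos hb) (pow_pos hr b)
  have hfn : ∀ x : ℕ, 0 ≤ v (f.coeff x) * r ^ x := fun x => mul_nonneg (v.nonneg _) (pow_nonneg hr.le x)
  have hgn : ∀ x : ℕ, 0 ≤ v (g.coeff x) * r ^ x := fun x => mul_nonneg (v.nonneg _) (pow_nonneg hr.le x)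
  -- weighted product of a pair ≠ (a, b) is strictly below the product of the maxima
  have hprod : ∀ x y : ℕ, ¬ (x = a ∧ y = b) →
      (v (f.coeff x) * r ^ x) * (v (g.coeff y) * r ^ y) < (v (f.coeff a) * r ^ a) * (v (g.coeff b) * r ^ b) := by
    intro x y hxy
    by_cases hx : x = a
    · have hy : y ≠ b := fun hy => hxy ⟨hx, hy⟩
      rw [hx]
      exact mul_lt_mul_of_pos_left (hgb y hy) hwa
    · rcases eq_or_ne y b with hy | hy
      · rw [hy]
        exact mul_lt_mul_of_pos_right (hfa x hx) hwb
      · exact mul_lt_mul'' (hfa x hx) (hgb y hy) (hfn x) (hgn y)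
  have hcoeff : v ((f * g).coeff (a + b)) = v (f.coeff a) * v (g.coeff b) := by
    rw [Polynomial.coeff_mul]
    have hk : (a, b) ∈ HasAntidiagonal.antidiagonal (a + b) := by
      rw [HasAntidiagonal.mem_antidiagonal]
    rw [IsNonarchimedean.apply_sum_eq_of_lt hv (fun x => (v.map_neg x).symm) hk ?_]
    · rw [map_mul]
    · intro x hx hne
      rw [HasAntidiagonal.mem_antidiagonal] at hx
      have hxE : ¬ (x.1 = a ∧ x.2 = b) := fun h => hne (Prod.ext h.1 h.2)
      have h1 := hprod x.1 x.2 hxE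
      rw [map_mul, map_mul]
      have hr2 : r ^ x.1 * r ^ x.2 = r ^ a * r ^ b := by rw [← pow_add, ← pow_add, hx]
      have hpos : 0 < r ^ a * r ^ b := by positivity
      have h1' : v (f.coeff x.1) * v (g.coeff x.2) * (r ^ x.1 * r ^ x.2)
          < v (f.coeff a) * v (g.coeff b) * (r ^ a * r ^ b) := by
        calc v (f.coeff x.1) * v (g.coeff x.2) * (r ^ x.1 * r ^ x.2)
            = (v (f.coeff x.1) * r ^ x.1) * (v (g.coeff x.2) * r ^ x.2) := by ring
          _ < (v (f.coeff a) * r ^ a) * (v (g.coeff b) * r ^ b) := h1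
          _ = v (f.coeff a) * v (g.coeff b) * (r ^ a * r ^ b) := by ring
      rw [hr2] at h1'
      exact lt_of_mul_lt_mul_right h1' hpos.le
  refine ⟨hcoeff, fun G hne => ?_⟩
  have hne' : (HasAntidiagonal.antidiagonal G).Nonempty := ⟨(0, G), by rw [HasAntidiagonal.mem_antidiagonal, zero_add]⟩
  obtain ⟨x, hx, hle⟩ :=
    IsNonarchimedean.finset_image_add_of_nonempty hv (fun x : ℕ × ℕ => f.coeff x.1 * g.coeff x.2) hne'
  rw [HasAntidiagonal.mem_antidiagonal] at hx
  have hcG : (f * g).coeff G = ∑ x ∈ HasAntidiagonal.antidiagonal G, f.coeff x.1 * g.coeff x.2 := Polynomial.coeff_mul f g G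
  have hxE : ¬ (x.1 = a ∧ x.2 = b) := by
    rintro ⟨h1, h2⟩
    exact hne (by rw [← hx, h1, h2])
  have h1 := hprod x.1 x.2 hxE
  calc v ((f * g).coeff G) * r ^ G ≤ v (f.coeff x.1 * g.coeff x.2) * r ^ G := by
        rw [hcG]
        exact mul_le_mul_of_nonneg_right hle (pow_nonneg hr.le G)
    _ = (v (f.coeff x.1) * r ^ x.1) * (v (g.coeff x.2) * r ^ x.2) := by
        rw [map_mul, ← hx, pow_add]; ring
    _ < (v (f.coeff a) * r ^ a) * (v (g.coeff b) * r ^ b) := h1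
    _ = v ((f * g).coeff (a + b)) * r ^ (a + b) := by
        rw [hcoeff, pow_add]; ring

/-- **a dominant exponent of a product splits** (non-archimedean `v`): if `G` strictly dominates `f * g` at the radius `r > 0` (against
all other indices), then `f` has a unique maximal weighted index `a`, `g` a unique maximal weighted index `b`, both strictly dominating,
and `G = a + b`. [elementary, ultrametric] -/
theorem exists_dominant_pair_of_dominant_mul (v : AbsoluteValue F ℝ) (hv : IsNonarchimedean v) (f g : F[X]) {G : ℕ} {r : ℝ}
    (hr : 0 < r) (hG : (f * g).coeff G ≠ 0)
    (hdom : ∀ G' : ℕ, G' ≠ G → v ((f * g).coeff G') * r ^ G' < v ((f * g).coeff G) * r ^ G) :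
    ∃ a b : ℕ, f.coeff a ≠ 0 ∧ g.coeff b ≠ 0 ∧ a + b = G ∧
      (∀ a' : ℕ, a' ≠ a → v (f.coeff a') * r ^ a' < v (f.coeff a) * r ^ a) ∧
      (∀ b' : ℕ, b' ≠ b → v (g.coeff b') * r ^ b' < v (g.coeff b) * r ^ b) := by
  have hf0 : f ≠ 0 := by rintro rfl; exact hG (by rw [zero_mul, coeff_zero])
  have hg0 : g ≠ 0 := by rintro rfl; exact hG (by rw [mul_zero, coeff_zero])
  have hfs : f.support.Nonempty := Polynomial.support_nonempty.2 hf0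
  have hgs : g.support.Nonempty := Polynomial.support_nonempty.2 hg0
  set wf : ℕ → ℝ := fun x => v (f.coeff x) * r ^ x with hwf
  set wg : ℕ → ℝ := fun x => v (g.coeff x) * r ^ x with hwg
  have hfn : ∀ x : ℕ, 0 ≤ wf x := fun x => mul_nonneg (v.nonneg _) (pow_nonneg hr.le x)
  have hgn : ∀ x : ℕ, 0 ≤ wg x := fun x => mul_nonneg (v.nonneg _) (pow_nonneg hr.le x)
  -- maxima over the supports
  obtain ⟨a₀, ha₀, hamax⟩ := Finset.exists_max_image f.support wf hfs
  obtain ⟨b₀, hb₀, hbmax⟩ := Finset.exists_max_image g.support wg hgs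
  have hamax' : ∀ x : ℕ, wf x ≤ wf a₀ := by
    intro x
    by_cases hx : x ∈ f.support
    · exact hamax x hx
    · simp only [hwf, Polynomial.notMem_support_iff.1 hx, map_zero, zero_mul]
      exact hfn a₀
  have hbmax' : ∀ x : ℕ, wg x ≤ wg b₀ := by
    intro x
    by_cases hx : x ∈ g.support
    · exact hbmax x hx
    · simp only [hwg, Polynomial.notMem_support_iff.1 hx, map_zero, zero_mul]
      exact hgn b₀
  -- the sets of maximisers and their extremes
  set Af := f.support.filter fun x => wf x = wf a₀ with hAf
  set Bg := g.support.filter fun x => wg x = wg b₀ with hBg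
  have hAne : Af.Nonempty := ⟨a₀, Finset.mem_filter.2 ⟨ha₀, rfl⟩⟩
  have hBne : Bg.Nonempty := ⟨b₀, Finset.mem_filter.2 ⟨hb₀, rfl⟩⟩
  -- KEY: for (a, b) = (min Af, min Bg) and (max Af, max Bg) the (a+b)-coefficient of f*g has the top weight wf a₀ * wg b₀
  have hultra : ∀ G' : ℕ, v ((f * g).coeff G') * r ^ G' ≤ wf a₀ * wg b₀ := by
    intro G'
    have hne' : (HasAntidiagonal.antidiagonal G').Nonempty := ⟨(0, G'), by rw [HasAntidiagonal.mem_antidiagonal, zero_add]⟩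
    obtain ⟨x, hx, hle⟩ :=
      IsNonarchimedean.finset_image_add_of_nonempty hv (fun x : ℕ × ℕ => f.coeff x.1 * g.coeff x.2) hne'
    rw [HasAntidiagonal.mem_antidiagonal] at hx
    calc v ((f * g).coeff G') * r ^ G' ≤ v (f.coeff x.1 * g.coeff x.2) * r ^ G' := by
          rw [Polynomial.coeff_mul]
          exact mul_le_mul_of_nonneg_right hle (pow_nonneg hr.le G')
      _ = wf x.1 * wg x.2 := by rw [map_mul, ← hx, pow_add]; simp only [hwf, hwg]; ring
      _ ≤ wf a₀ * wg b₀ := mul_le_mul (hamax' _) (hbmax' _) (hgn _) (hfn _)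
  have htop : ∀ a b : ℕ, a ∈ Af → b ∈ Bg →
      (∀ x y : ℕ, x + y = a + b → (x, y) ≠ (a, b) → wf x * wg y < wf a₀ * wg b₀) →
      v ((f * g).coeff (a + b)) * r ^ (a + b) = wf a₀ * wg b₀ := by
    intro a b haA hbB hoth
    obtain ⟨-, hwa⟩ := Finset.mem_filter.1 haA
    obtain ⟨-, hwb⟩ := Finset.mem_filter.1 hbB
    rw [Polynomial.coeff_mul]
    have hk : (a, b) ∈ HasAntidiagonal.antidiagonal (a + b) := by rw [HasAntidiagonal.mem_antidiagonal]
    have hrab : 0 < r ^ (a + b) := pow_pos hr _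
    rw [IsNonarchimedean.apply_sum_eq_of_lt hv (fun x => (v.map_neg x).symm) hk ?_]
    · rw [map_mul, ← hwa, ← hwb]; simp only [hwf, hwg]; rw [pow_add]; ring
    · intro x hx hne
      rw [HasAntidiagonal.mem_antidiagonal] at hx
      have h1 := hoth x.1 x.2 hx (fun h => hne h)
      rw [← hwa, ← hwb] at h1
      -- h1 : wf x1 * wg x2 < wf a * wg b ; compare coefficient valuations by dividing out r^(a+b) = r^x1 * r^x2
      have h2 : v (f.coeff x.1 * g.coeff x.2) * r ^ (a + b) < v (f.coeff a * g.coeff b) * r ^ (a + b) := by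
        rw [map_mul, map_mul]
        calc v (f.coeff x.1) * v (g.coeff x.2) * r ^ (a + b) = wf x.1 * wg x.2 := by
              rw [← hx, pow_add]; simp only [hwf, hwg]; ring
          _ < wf a * wg b := h1
          _ = v (f.coeff a) * v (g.coeff b) * r ^ (a + b) := by simp only [hwf, hwg]; rw [pow_add]; ring
      exact lt_of_mul_lt_mul_right h2 hrab.le
  -- the two extreme pairs
  set a₁ := Af.min' hAne with ha₁
  set b₁ := Bg.min' hBne with hb₁
  set a₂ := Af.max' hAne with ha₂
  set b₂ := Bg.max' hBne with hb₂
  have ha₁A : a₁ ∈ Af := Finset.min'_mem Af hAne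
  have hb₁B : b₁ ∈ Bg := Finset.min'_mem Bg hBne
  have ha₂A : a₂ ∈ Af := Finset.max'_mem Af hAne
  have hb₂B : b₂ ∈ Bg := Finset.max'_mem Bg hBne
  -- non-maximisers are strictly below
  have hltA : ∀ x : ℕ, x ∉ Af → wf x < wf a₀ := by
    intro x hx
    refine lt_of_le_of_ne (hamax' x) fun h => hx ?_
    have hxs : x ∈ f.support := by
      rw [Polynomial.mem_support_iff]; intro h0
      have : wf x = 0 := by simp only [hwf, h0, map_zero, zero_mul]
      rw [this] at h
      have hpos : 0 < wf a₀ := mul_pos (v.pos (Polynomial.mem_support_iff.1 ha₀)) (pow_pos hr _)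
      exact hpos.ne h
    exact Finset.mem_filter.2 ⟨hxs, h⟩
  have hltB : ∀ x : ℕ, x ∉ Bg → wg x < wg b₀ := by
    intro x hx
    refine lt_of_le_of_ne (hbmax' x) fun h => hx ?_
    have hxs : x ∈ g.support := by
      rw [Polynomial.mem_support_iff]; intro h0
      have : wg x = 0 := by simp only [hwg, h0, map_zero, zero_mul]
      rw [this] at h
      have hpos : 0 < wg b₀ := mul_pos (v.pos (Polynomial.mem_support_iff.1 hb₀)) (pow_pos hr _)
      exact hpos.ne h
    exact Finset.mem_filter.2 ⟨hxs, h⟩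
  have hwapos : 0 < wf a₀ := mul_pos (v.pos (Polynomial.mem_support_iff.1 ha₀)) (pow_pos hr _)
  have hwbpos : 0 < wg b₀ := mul_pos (v.pos (Polynomial.mem_support_iff.1 hb₀)) (pow_pos hr _)
  have hbelow : ∀ x y : ℕ, (x ∉ Af ∨ y ∉ Bg) → wf x * wg y < wf a₀ * wg b₀ := by
    intro x y hxy
    rcases hxy with hx | hy
    · calc wf x * wg y ≤ wf x * wg b₀ := mul_le_mul_of_nonneg_left (hbmax' y) (hfn x)
        _ < wf a₀ * wg b₀ := mul_lt_mul_of_pos_right (hltA x hx) hwbpos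
    · calc wf x * wg y ≤ wf a₀ * wg y := mul_le_mul_of_nonneg_right (hamax' x) (hgn y)
        _ < wf a₀ * wg b₀ := mul_lt_mul_of_pos_left (hltB y hy) hwapos
  -- the two extreme sums carry the top weight
  have hE₁ : v ((f * g).coeff (a₁ + b₁)) * r ^ (a₁ + b₁) = wf a₀ * wg b₀ := by
    refine htop a₁ b₁ ha₁A hb₁B fun x y hxy hne => ?_
    by_cases hx : x ∈ Af
    · by_cases hy : y ∈ Bg
      · exfalso
        have h1 : a₁ ≤ x := Finset.min'_le Af x hx
        have h2 : b₁ ≤ y := Finset.min'_le Bg y hy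
        exact hne (Prod.ext (by simp only; omega) (by simp only; omega))
      · exact hbelow x y (Or.inr hy)
    · exact hbelow x y (Or.inl hx)
  have hE₂ : v ((f * g).coeff (a₂ + b₂)) * r ^ (a₂ + b₂) = wf a₀ * wg b₀ := by
    refine htop a₂ b₂ ha₂A hb₂B fun x y hxy hne => ?_
    by_cases hx : x ∈ Af
    · by_cases hy : y ∈ Bg
      · exfalso
        have h1 : x ≤ a₂ := Finset.le_max' Af x hx
        have h2 : y ≤ b₂ := Finset.le_max' Bg y hy
        exact hne (Prod.ext (by simp only; omega) (by simp only; omega))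
      · exact hbelow x y (Or.inr hy)
    · exact hbelow x y (Or.inl hx)
  -- hence both extreme sums equal G
  have hG₁ : a₁ + b₁ = G := by
    by_contra hne
    have h1 := hdom _ hne
    rw [hE₁] at h1
    exact absurd (hultra G) (not_le.2 h1)
  have hG₂ : a₂ + b₂ = G := by
    by_contra hne
    have h1 := hdom _ hne
    rw [hE₂] at h1
    exact absurd (hultra G) (not_le.2 h1)
  have ha₁₂ : a₁ ≤ a₂ := Finset.min'_le Af a₂ ha₂A
  have hb₁₂ : b₁ ≤ b₂ := Finset.min'_le Bg b₂ hb₂B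
  have haeq : a₁ = a₂ := by omega
  have hbeq : b₁ = b₂ := by omega
  refine ⟨a₁, b₁, Polynomial.mem_support_iff.1 (Finset.mem_filter.1 ha₁A).1,
    Polynomial.mem_support_iff.1 (Finset.mem_filter.1 hb₁B).1, hG₁, fun a' ha' => ?_, fun b' hb' => ?_⟩
  · have hna : a' ∉ Af := by
      intro h
      have h1 : a₁ ≤ a' := Finset.min'_le Af a' h
      have h2 : a' ≤ a₂ := Finset.le_max' Af a' h
      exact ha' (by omega)
    have := hltA a' hna
    rw [← (Finset.mem_filter.1 ha₁A).2] at this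
    exact this
  · have hnb : b' ∉ Bg := by
      intro h
      have h1 : b₁ ≤ b' := Finset.min'_le Bg b' h
      have h2 : b' ≤ b₂ := Finset.le_max' Bg b' h
      exact hb' (by omega)
    have := hltB b' hnb
    rw [← (Finset.mem_filter.1 hb₁B).2] at this
    exact this

/-- **dominant indices move up with the radius**: if `a` strictly dominates `f` at `r` and `a'` at `r' > r`, then `a ≤ a'`. [elementary] -/
theorem dominantAt_mono (v : AbsoluteValue F ℝ) (f : F[X]) {a a' : ℕ} {r r' : ℝ} (hr : 0 < r) (hrr' : r < r')
    (ha : ∀ x : ℕ, x ≠ a → v (f.coeff x) * r ^ x < v (f.coeff a) * r ^ a)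
    (ha' : ∀ x : ℕ, x ≠ a' → v (f.coeff x) * r' ^ x < v (f.coeff a') * r' ^ a') : a ≤ a' := by
  by_contra hlt
  push Not at hlt
  obtain ⟨k, rfl⟩ : ∃ k, a = a' + k := ⟨a - a', by omega⟩
  have hk0 : k ≠ 0 := by omega
  have h1 := ha a' (by omega)
  have h2 := ha' (a' + k) (by omega)
  rw [pow_add] at h1 h2
  set α := v (f.coeff (a' + k)) with hα
  set β := v (f.coeff a') with hβ
  have hαn : 0 ≤ α := v.nonneg _
  have hβn : 0 ≤ β := v.nonneg _
  have hr' : 0 < r' := hr.trans hrr'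
  have hra : 0 < r ^ a' := pow_pos hr a'
  have hr'a : 0 < r' ^ a' := pow_pos hr' a'
  have h1' : β < α * r ^ k := by
    have h : β * r ^ a' < (α * r ^ k) * r ^ a' := by linarith [h1]
    exact lt_of_mul_lt_mul_right h hra.le
  have h2' : α * r' ^ k < β := by
    have h : (α * r' ^ k) * r' ^ a' < β * r' ^ a' := by linarith [h2]
    exact lt_of_mul_lt_mul_right h hr'a.le
  have hα0 : 0 < α := by
    by_contra h
    push Not at h
    have h0 : α = 0 := le_antisymm h hαn
    rw [h0, zero_mul] at h1'
    exact absurd h1' (not_lt.2 hβn)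
  have h3 : r ^ k < r' ^ k := pow_lt_pow_left₀ hrr' hr.le hk0
  have h4 : α * r ^ k < α * r' ^ k := mul_lt_mul_of_pos_left h3 hα0
  linarith

end Summit.ValiantsHypothesis.ValiantsHypothesis.Theorems.KPlusLogSqLaw.ValDoor
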